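import Mathlib
import Summits.Ventures.PercRepro2.K5HyperKron

/-!
# FROM THE STAR-COMPARISON CERTIFICATES TO THE COEFFICIENT INEQUALITIES
(blind cell PercRepro2, typer-1 g10; the digit bridge of `K5Hyper.lean` in base `KB3 = 2^23`,
`K5Digits.lean` with `20 → 23`, `19 → 22`)

A certificate `CertLE M P` (`K5Hyper.lean`) for numbers `P = Σ_k a k · KB3^{idx4 k}`, `M = Σ_k b k · KB3^{idx4 k}`
with coefficients below `KB3` gives `b k ≤ a k` at every profile `k`: the digits of `P`, `M` are the
coefficients, the mask test bounds the digits of `M` and of the difference below `2^22`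
(`digit_lt_of_land_mask3`), so the subtraction borrows nowhere (**`le_of_certLE`**, as
`K5TypedK3.le_of_kron_le'`).  `K5HyperCoeffs.lean` applies it to the star comparisons.
-/

namespace Summit.Ventures.PercRepro2

namespace K5

/-! ## The mask at bit `22` of every base-`KB3` digit -/

section Mask3

/-- `KB3 = 2^23`. -/
lemma KB3_eq : KB3 = 2 ^ 23 := rfl

/-- `KB3^j = 2^(23 j)`. -/
lemma KB3_pow (j : ℕ) : KB3 ^ j = 2 ^ (23 * j) := by
  rw [KB3_eq, ← pow_mul]

/-- The scaled geometric sum, for any length `m`. -/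
lemma scaled_geomSum3 (m : ℕ) :
    2 ^ 22 * ((KB3 ^ m - 1) / (KB3 - 1)) = ∑ j ∈ Finset.range m, 2 ^ 22 * KB3 ^ j := by
  rw [← Nat.geomSum_eq (by rw [KB3_eq]; norm_num) m]
  exact Finset.mul_sum _ _ _

/-- The mask is `Σ_{j < 4^10} 2^22 · KB3^j`. -/
lemma mask3_eq : mask3 = ∑ j ∈ Finset.range (4 ^ 10), 2 ^ 22 * KB3 ^ j := scaled_geomSum3 (4 ^ 10)

/-- Every base-`KB3` digit of the mask is `2^22`. -/
lemma mask3_digit {j : ℕ} (hj : j < 4 ^ 10) : mask3 / KB3 ^ j % KB3 = 2 ^ 22 := by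
  rw [mask3_eq]
  exact digit_sum (B := KB3) (by rw [KB3_eq]; norm_num) (fun _ => 2 ^ 22) (4 ^ 10)
    (fun _ _ => by rw [KB3_eq]; norm_num) j hj

/-- Bit `22` of the base-`KB3` digit `j` of `X` is the bit `23 j + 22` of `X`. -/
lemma testBit_digit3 (X j : ℕ) :
    X.testBit (23 * j + 22) = decide ((X / KB3 ^ j % KB3) / 2 ^ 22 = 1) := by
  rw [Nat.testBit_eq_decide_div_mod_eq, KB3_pow, KB3_eq]
  congr 1
  have h1 : X / 2 ^ (23 * j + 22) = X / 2 ^ (23 * j) / 2 ^ 22 := by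
    rw [Nat.div_div_eq_div_mul, ← pow_add]
  have h2 : X / 2 ^ (23 * j) % 2 ^ 23 / 2 ^ 22 = X / 2 ^ (23 * j) / 2 ^ 22 % 2 := by
    rw [show (2 : ℕ) ^ 23 = 2 ^ 22 * 2 from by norm_num, Nat.mod_mul_right_div_self]
  rw [h1, h2]

/-- Bit `23 j + 22` of the mask is set for `j < 4^10`. -/
lemma mask3_testBit {j : ℕ} (hj : j < 4 ^ 10) : mask3.testBit (23 * j + 22) = true := by
  rw [testBit_digit3, mask3_digit hj, Nat.div_self (by norm_num), decide_eq_true_iff]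

/-- **The mask test bounds the digits**: `Nat.land X mask3 = 0` forces every base-`KB3` digit of `X`
below `2^22`. -/
theorem digit_lt_of_land_mask3 {X : ℕ} (h : Nat.land X mask3 = 0) {j : ℕ} (hj : j < 4 ^ 10) :
    X / KB3 ^ j % KB3 < 2 ^ 22 := by
  have hbit : X.testBit (23 * j + 22) = false := by
    change X &&& mask3 = 0 at h
    have := congrArg (fun n => n.testBit (23 * j + 22)) h
    simp only [Nat.testBit_land, Nat.zero_testBit] at this
    rwa [mask3_testBit hj, Bool.and_true] at this
  rw [testBit_digit3, decide_eq_false_iff_not] at hbit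
  have hlt : X / KB3 ^ j % KB3 < KB3 := Nat.mod_lt _ (by rw [KB3_eq]; norm_num)
  rw [KB3_eq] at hlt
  have hq : X / KB3 ^ j % KB3 / 2 ^ 22 < 2 := by
    rw [Nat.div_lt_iff_lt_mul (by norm_num)]
    calc X / KB3 ^ j % KB3 < 2 ^ 23 := hlt
      _ = 2 * 2 ^ 22 := by norm_num
  have hq0 : X / KB3 ^ j % KB3 / 2 ^ 22 = 0 := by omega
  rwa [Nat.div_eq_zero_iff_lt (by norm_num)] at hq0

end Mask3

/-! ## The digit argument in base `KB3` -/

section Bridge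

/-- A sum over the profiles re-indexed over `range (4^10)` through `decode4`. -/
lemma sum_profiles_eq3 (c : (Fin 10 → Fin 4) → ℕ) :
    ∑ k, c k * KB3 ^ idx4 k = ∑ j ∈ Finset.range (4 ^ 10), c (decode4 j) * KB3 ^ j := by
  refine Finset.sum_nbij' idx4 decode4 (fun k _ => ?_) (fun j _ => Finset.mem_univ _)
    (fun k _ => decode4_idx4 k) (fun j hj => ?_) (fun k _ => ?_)
  · exact Finset.mem_range.2 (idx4_lt k)
  · exact idx4_decode4 (Finset.mem_range.1 hj)
  · rw [decode4_idx4]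

/-- **The digit argument in base `KB3`** with the third mask test: if `P = Σ_k a k KB3^{idx4 k}`,
`M = Σ_k b k KB3^{idx4 k}` with `a, b < KB3`, `M ≤ P`, `Nat.land (P − M) mask3 = 0` and
`Nat.land M mask3 = 0`, then `b k ≤ a k` for every profile `k`. -/
theorem le_of_kron_le3 (a b : (Fin 10 → Fin 4) → ℕ) (ha : ∀ k, a k < KB3) (hb : ∀ k, b k < KB3)
    {P M : ℕ} (hP : P = ∑ k, a k * KB3 ^ idx4 k) (hM : M = ∑ k, b k * KB3 ^ idx4 k) (hle : M ≤ P)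
    (hmask : Nat.land (P - M) mask3 = 0) (hmaskM : Nat.land M mask3 = 0) (k : Fin 10 → Fin 4) :
    b k ≤ a k := by
  have hKB : 2 ≤ KB3 := by rw [KB3_eq]; norm_num
  have hb' : ∀ k, b k < 2 ^ 22 := by
    intro k
    have hj : idx4 k < 4 ^ 10 := idx4_lt k
    have h1 : M / KB3 ^ idx4 k % KB3 = b k := by
      rw [hM, sum_profiles_eq3]
      rw [digit_sum hKB (fun j => b (decode4 j)) (4 ^ 10) (fun j _ => hb _) (idx4 k) hj, decode4_idx4]
    rw [← h1]
    exact digit_lt_of_land_mask3 hmaskM hj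
  set D := P - M with hD
  have hDM : P = D + M := by omega
  have hdlt : ∀ j < 4 ^ 10, D / KB3 ^ j % KB3 < 2 ^ 22 := fun j hj => digit_lt_of_land_mask3 hmask hj
  have hPlt : P < KB3 ^ (4 ^ 10) := by
    rw [hP, sum_profiles_eq3]
    exact sum_lt_pow hKB _ _ fun j _ => ha _
  have hDlt : D < KB3 ^ (4 ^ 10) := by omega
  have hDsum := expand_digits hKB (4 ^ 10) D hDlt
  have hPsum : P = ∑ j ∈ Finset.range (4 ^ 10), (D / KB3 ^ j % KB3 + b (decode4 j)) * KB3 ^ j := by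
    rw [hDM, hM, sum_profiles_eq3]
    conv_lhs => rw [hDsum]
    rw [← Finset.sum_add_distrib]
    exact Finset.sum_congr rfl fun j _ => by ring
  have hj : idx4 k < 4 ^ 10 := idx4_lt k
  have h1 : P / KB3 ^ idx4 k % KB3 = a k := by
    rw [hP, sum_profiles_eq3]
    rw [digit_sum hKB (fun j => a (decode4 j)) (4 ^ 10) (fun j _ => ha _) (idx4 k) hj, decode4_idx4]
  have h2 : P / KB3 ^ idx4 k % KB3 = D / KB3 ^ idx4 k % KB3 + b k := by
    rw [hPsum]
    rw [digit_sum hKB (fun j => D / KB3 ^ j % KB3 + b (decode4 j)) (4 ^ 10)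
      (fun j hj' => by
        have := hdlt j hj'; have := hb' (decode4 j)
        have h2 : (2 : ℕ) ^ 22 + 2 ^ 22 = KB3 := by rw [KB3_eq]; norm_num
        omega) (idx4 k) hj,
      decode4_idx4]
  have e : a k = D / KB3 ^ idx4 k % KB3 + b k := h1.symm.trans h2
  rw [e]
  exact Nat.le_add_left _ _

/-- **A certificate `CertLE M P` gives the coefficient inequality** when `P`, `M` encode coefficients
below `KB3`. -/
theorem le_of_certLE (a b : (Fin 10 → Fin 4) → ℕ) (ha : ∀ k, a k < KB3) (hb : ∀ k, b k < KB3)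
    {P M : ℕ} (hP : P = ∑ k, a k * KB3 ^ idx4 k) (hM : M = ∑ k, b k * KB3 ^ idx4 k)
    (hc : CertLE M P) (k : Fin 10 → Fin 4) : b k ≤ a k :=
  le_of_kron_le3 a b ha hb hP hM hc.1 hc.2.1 hc.2.2 k

/-- Two encodings add (coefficient functions abstract). -/
lemma sum_add_mulB (f g : (Fin 10 → Fin 4) → ℕ) :
    ∑ k, f k * KB3 ^ idx4 k + ∑ k, g k * KB3 ^ idx4 k = ∑ k, (f k + g k) * KB3 ^ idx4 k := by
  rw [← Finset.sum_add_distrib]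
  exact Finset.sum_congr rfl fun k _ => (add_mul _ _ _).symm

end Bridge

end K5

end Summit.Ventures.PercRepro2
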